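import Literature.NumberTheory.PAdicHodge.BdRPlusFormalLogTheta
import Literature.NumberTheory.PAdicHodge.BdRPlusFormalLogKummer
import HarnessLib

/-!
# The kernel of `θ` on Fontaine's integrating elements: `θ(log_W(ι[ũ])) = 0 ⟹ p^N · log_W(ι[ũ]) ≡ log_W(ι(p^N[ũ])) ∈ Fil¹` with `θ(p^N[ũ]) = 0`

Topic `Literature/NumberTheory/PAdicHodge`; namespace `Literature.NumberTheory.PAdicHodge.GaloisContinuity`. THEOREMS ONLY (no definition, no instance,
no named fact, no `sorry`). Sequel of `BdRPlusFormalLogTheta` (`θ(L) = log_ω(P(u₀))` for a value `L` of `log_W(ι[ũ])` modulo `Fil^k`, `[ũ]` Fontaine's integral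
of a `[p]`-division sequence `u` of a point `P(u₀) ∈ Ŵ(p𝒪_{ℂ_F})`) — the KERNEL half of the fundamental exact sequence of the «`X_W` road»
(memo `Summits/…/Cruxes/StarredOptimalManinUnitFiveSeven/Lines/kato-lever-K3-H4-log.md` §3b (iii), `…-K3-H4-theta.md` §3):

* `IsFormalLogModFil.nsmul_pt` — **`j • L` is a value of `log_W` at `j • Q`** for a point `Q ∈ Ŵ(𝔫)` with `‖θ(Q)‖ ≤ ‖p‖` (`j ≥ 1`; additivity
  `IsFormalLogModFil.addW`, the `(p, ξ)`-coordinates being automatic from `‖θ(j • Q)‖ ≤ ‖θ(Q)‖ ≤ ‖p‖`, `(p, ξ) = θ⁻¹(p𝒪_{ℂ_F})`);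
* `eq_zero_of_nsmul_eq_zero_of_not_dvd` — **`E₁(K)` has no prime-to-`p` torsion** (`‖m'‖ = 1` for `p ∤ m'`, chart estimate `|z(m'Q) − m' z(Q)| ≤ |z(Q)|²`);
  `exists_pow_nsmul_eq_zero_of_isOfFinAddOrder` — torsion points of `E₁(K)` are `p`-power torsion;
* ★★ `IsFormalLogModFil.exists_pow_smul_sub_logKer_mem` — **KERNEL**: for `‖u₀‖ ≤ ‖p‖`, `k ≥ 1`, `L` a value of `log_W(ι[ũ])` modulo `Fil^k` with `θ(L) = 0`:
  there is `N` with `θ(p^N • [ũ]) = 0` in `Ŵ(𝔪_{ℂ_F})` and **`p^N · L − logKer(p^N • [ũ]) ∈ ξ^k B_dR⁺`**, where `logKer` is K1's `ξ`-adic logarithm of a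
  `θ`-kernel point of `Ŵ(𝔫)` (`AinfWeierstrassKummerIntegral`; `∈ Fil¹`, and `= ∫_τ ω` on `T_pŴ`, `logKer_torsionLiftHom`). Proof: `0 = θ(L) = log_ω(P(u₀))`
  (`thetaBdR_eq_padicLogPointFiniteExt_ptOfZ`) ⟹ `P(u₀)` torsion (`padicLogPointFiniteExt_eq_zero_iff`) ⟹ `p^N • P(u₀) = 0` ⟹ `θ(p^N • [ũ]) = p^N • θ[ũ] = 0`;
  `p^N • L` and `logKer` are both values at `p^N • [ũ]` (`nsmul_pt`, `isFormalLogModFil_logKer`), hence congruent modulo `ξ^k`.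
* `IsFormalLogModFil.exists_pow_smul_mem_filOne_add` — hence **`p^N · L ∈ Fil¹ B_dR⁺ + ξ^k B_dR⁺`**... stated as `p^N L − b ∈ ξ^k` with `b ∈ Fil¹`.

* §4 (`T_pŴ` currency): `mulPC_eq_val_nsmul`, `mulPC_val_nsmul_pt` (the termwise multiple `vᵢ = [n]_W uᵢ` is a division sequence),
  ★ `divisionLiftPt_val_nsmul_pt` (`[ṽ] = n • [ũ]`: Fontaine's integration is `ℕ`-linear in the sequence), ★★
  `IsFormalLogModFil.exists_pow_mul_sub_omegaPeriod_mem` — `θ(L) = 0 ⟹ ∃ N`, `v = [p^N]_W u` is a TORSION sequence (`v₀ = 0`, `v ∈ T_pŴ`) and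
  **`p^N · L − ∫_v ω ∈ ξ^k B_dR⁺`** (`∫_v ω = AinfTop.omegaPeriod`): `ker(θ|X_W) = ℚ_p ⊗ ∫_{T_pŴ} ω` modulo `Fil^k`.

* §5 (choice of the division sequence): `coe_addSeq_negSeq_zero_of_eq`, `addSeq_addSeq_negSeq`, ★★ `IsFormalLogModFil.sub_sub_omegaPeriod_mem_of_base_eq` — for two
  division sequences `u`, `u'` of the SAME point of `Ŵ(p𝒪_{ℂ_F})` and values `L`, `L'`: **`L' − L − ∫_{u' ⊖ u} ω ∈ ξ^k B_dR⁺`** (`u' ⊖ u ∈ T_pŴ`): the integrating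
  element of a point is well defined modulo `Fil^k + ∫_{T_pŴ} ω`.

So on `X_W := ℚ_p·{log_W(ι[ũ]) : u}` (values modulo `Fil^k`) the kernel of `θ` is spanned, up to `p`-power denominators and `Fil^k`, by the `ξ`-adic logarithms of
`θ`-kernel points — the elliptic analogue of `IsLogModFil.exists_pow_mul_sub_mul_tBdR_mem` (`BdRPlusLogLatticeKernel`, the `𝔾_m` case `p^N L − a t ∈ ξ^k`).
Crux K★ `stmt-BirchSwinnertonDyer-22226`, floor (H4) step (3). Infrastructure only; BSD / K★ are not proved by any of this.

## References
* J.-M. Fontaine, *Formes différentielles et modules de Tate…*, Invent. Math. 65 (1982), §5 (the sequence `0 → V_p → … → ℂ → 0`). [Fontaine1982FormesDifferentielles]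
* J.-M. Fontaine, *Le corps des périodes p-adiques*, Astérisque 223 (1994), Exp. II §1.5. [FontaineAsterisque223III]
* J. H. Silverman, *The Arithmetic of Elliptic Curves* (2009), Prop. IV.3.2, Thm. IV.6.4, Prop. VII.2.2. [SilvermanAEC2009]
-/

noncomputable section

namespace Literature.NumberTheory.PAdicHodge

namespace GaloisContinuity

open scoped NNReal Classical
open ValuativeRel Field Ideal WittVector Filter
open _root_.Topology
open Literature.NumberTheory.GaloisRepresentations Literature.NumberTheory.GaloisRepresentations.IsNonarchimedeanLocalField
open Literature.NumberTheory.GaloisRepresentations.LubinTate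
open Literature.NumberTheory.EllipticCurves Literature.NumberTheory.EllipticCurves.FormalGroupChart

variable {F : Type} [Field F] [ValuativeRel F] [TopologicalSpace F] [IsNonarchimedeanLocalField F]
  [CharZero F] {p : ℕ} [Fact p.Prime] [Fact (¬ IsUnit (p : integerC F))]
  [IsAdicComplete (Ideal.span {(p : integerC F)}) (integerC F)]
  {hθ : Function.Surjective (fontaineTheta (integerC F) p)} (W : WeierstrassCurve ℤ)

/-! ## §1 Multiples of a point of `Ŵ(𝔫)` over `Ŵ(p𝒪_{ℂ_F})` and of its logarithm -/

/-- **A point `Q ∈ Ŵ(𝔫)` with `‖θ(Q)‖ ≤ ‖p‖` has its coordinate in `(p, ξ)`** (`(p, ξ) = θ⁻¹(p𝒪_{ℂ_F})`, `mem_span_p_xi_iff_norm_fontaineTheta_le`).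
[cite: FontaineAsterisque223III, Exp. II §1.2.2] -/
theorem mem_span_p_xi_of_norm_thetaPt_le {Q : W.Pt (AinfTop.nilTheta F p hθ)}
    (hQ : ‖(((AinfTop.thetaPt W hθ Q).val : CBall F) : CompletedAlgClosure F)‖ ≤ ‖(p : CompletedAlgClosure F)‖) :
    (AinfTop.of F p).symm (Q.val : AinfTop F p) ∈ Ideal.span {(p : Ainf (p := p) F), xi} := by
  rw [mem_span_p_xi_iff_norm_fontaineTheta_le hθ, ← AinfTop.coe_theta, RingEquiv.apply_symm_apply, ← AinfTop.coe_val_thetaPt]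
  exact hQ

omit [CharZero F] [Fact p.Prime] [Fact (¬ IsUnit (p : integerC F))] [IsAdicComplete (Ideal.span {(p : integerC F)}) (integerC F)] in
/-- **`‖[n]_W(t)‖ ≤ ‖t‖` on `Ŵ(𝔪_{ℂ_F})`** (`[n]_W` has no constant term and integral coefficients). [cite: SilvermanAEC2009, IV.2.3] -/
theorem norm_val_nsmul_le (Q : W.Pt (maxNilIdealC F)) (n : ℕ) :
    ‖(((n • Q).val : CBall F) : CompletedAlgClosure F)‖ ≤ ‖((Q.val : CBall F) : CompletedAlgClosure F)‖ := by
  rw [WeierstrassCurve.Pt.val_nsmul, coe_evalPt₁_eq_evalAt]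
  exact norm_evalAt_le_of_constantCoeff (K := CompletedAlgClosure F) Q.val (W.constantCoeff_formalMul n)

/-- **`‖θ(n • Q)‖ ≤ ‖θ(Q)‖`** for `Q ∈ Ŵ(𝔫)` (`θ` is a homomorphism `Ŵ(𝔫) → Ŵ(𝔪_{ℂ_F})`). [cite: SilvermanAEC2009, IV.2.3] -/
theorem norm_thetaPt_nsmul_le (Q : W.Pt (AinfTop.nilTheta F p hθ)) (n : ℕ) :
    ‖(((AinfTop.thetaPt W hθ (n • Q)).val : CBall F) : CompletedAlgClosure F)‖ ≤
      ‖(((AinfTop.thetaPt W hθ Q).val : CBall F) : CompletedAlgClosure F)‖ := by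
  rw [map_nsmul]
  exact norm_val_nsmul_le W _ n

/-- ★ **`j • L` is a value of `log_W` at `j • Q` modulo `Fil^k`** for `Q ∈ Ŵ(𝔫)` with `‖θ(Q)‖ ≤ ‖p‖`, `L` a value at `Q`, `j ≥ 1` (additivity `addW`, induction).
[cite: Fontaine1982FormesDifferentielles, §5] [cite: SilvermanAEC2009, IV.5.2] -/
theorem IsFormalLogModFil.nsmul_pt {k : ℕ} {Q : W.Pt (AinfTop.nilTheta F p hθ)}
    (hQ : ‖(((AinfTop.thetaPt W hθ Q).val : CBall F) : CompletedAlgClosure F)‖ ≤ ‖(p : CompletedAlgClosure F)‖)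
    {L : BDeRhamPlus (integerC F) p} (hL : IsFormalLogModFil W k ((AinfTop.of F p).symm (Q.val : AinfTop F p)) L) {j : ℕ} (hj : 1 ≤ j) :
    IsFormalLogModFil W k ((AinfTop.of F p).symm ((j • Q).val : AinfTop F p)) (j • L) := by
  induction j, hj using Nat.le_induction with
  | base => rwa [one_nsmul, one_nsmul]
  | succ j hj ih =>
    rw [succ_nsmul, succ_nsmul, AinfTop.val_add_N]
    exact IsFormalLogModFil.addW W (mem_span_p_xi_of_norm_thetaPt_le W ((norm_thetaPt_nsmul_le W Q j).trans hQ))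
      (mem_span_p_xi_of_norm_thetaPt_le W hQ) ih hL

/-! ## §2 Torsion in `E₁(K)` is `p`-power torsion -/

section Torsion

variable {K : Type*} [NontriviallyNormedField K] [IsUltrametricDist K] [CompleteSpace K] [(curveOver K W).IsElliptic]

omit [ValuativeRel F] [TopologicalSpace F] [IsNonarchimedeanLocalField F] [CharZero F] [Fact (¬ IsUnit (p : integerC F))]
  [IsAdicComplete (Ideal.span {(p : integerC F)}) (integerC F)] [CompleteSpace K] [(curveOver K W).IsElliptic] in
/-- **`E₁(K)` has no prime-to-`p` torsion**: for `p ∤ m'` and `Q ∈ E₁(K)`, `m' • Q = 0 ⟹ Q = 0` (`‖m'‖ = 1`, and `|z(m'Q) − m' z(Q)| ≤ |z(Q)|²` forces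
`|z(Q)| ≤ |z(Q)|²`, i.e. `z(Q) = 0`). [cite: SilvermanAEC2009, Prop. IV.3.2 with Prop. VII.2.2] -/
theorem eq_zero_of_nsmul_eq_zero_of_not_dvd (hp1 : ‖(p : K)‖ < 1) {m' : ℕ} (hm' : ¬ p ∣ m') {Q : (curveOver K W).toAffine.Point}
    (hQ : Q ∈ kernel (NormedField.valuation (K := K)) (curveOver K W)) (h : m' • Q = 0) : Q = 0 := by
  have hest := val_zCoord_nsmul_sub_le (w := NormedField.valuation (K := K)) hQ m'
  rw [h, WeierstrassCurve.Affine.Point.zCoord_zero, zero_sub, Valuation.map_neg, Valuation.map_mul] at hest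
  have hm1 : NormedField.valuation ((m' : K)) = 1 := by
    rw [← NNReal.coe_inj, NormedField.valuation_apply, coe_nnnorm, NNReal.coe_one]; exact Literature.NumberTheory.EllipticCurves.norm_natCast_eq_one_of_not_dvd hp1 hm'
  rw [hm1, one_mul] at hest
  have hlt := val_zCoord_lt_one hQ
  have hz : NormedField.valuation Q.zCoord = 0 := by
    by_contra hne
    have hpos : 0 < NormedField.valuation Q.zCoord := pos_iff_ne_zero.2 hne
    have : NormedField.valuation Q.zCoord ^ 2 < NormedField.valuation Q.zCoord := by
      rw [sq]; exact mul_lt_of_lt_one_left hpos hlt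
    exact absurd hest (not_le.2 this)
  exact (zCoord_eq_zero_iff hQ).1 ((Valuation.zero_iff _).1 hz)

omit [ValuativeRel F] [TopologicalSpace F] [IsNonarchimedeanLocalField F] [CharZero F] [Fact (¬ IsUnit (p : integerC F))]
  [IsAdicComplete (Ideal.span {(p : integerC F)}) (integerC F)] [CompleteSpace K] [(curveOver K W).IsElliptic] in
/-- **Torsion points of `E₁(K)` are `p`-power torsion**: `∃ N, p^N • Q = 0`. [cite: SilvermanAEC2009, Prop. IV.3.2 with Prop. VII.2.2] -/
theorem exists_pow_nsmul_eq_zero_of_isOfFinAddOrder (hp1 : ‖(p : K)‖ < 1) {Q : (curveOver K W).toAffine.Point}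
    (hQ : Q ∈ kernel (NormedField.valuation (K := K)) (curveOver K W)) (hfin : IsOfFinAddOrder Q) : ∃ N : ℕ, p ^ N • Q = 0 := by
  obtain ⟨m, hm, hmQ⟩ := hfin.exists_nsmul_eq_zero
  obtain ⟨N, m', hm', rfl⟩ := Nat.exists_eq_pow_mul_and_not_dvd hm.ne' p (Fact.out : p.Prime).ne_one
  refine ⟨N, eq_zero_of_nsmul_eq_zero_of_not_dvd W hp1 hm'
    ((kernel (NormedField.valuation (K := K)) (curveOver K W)).nsmul_mem hQ _) ?_⟩
  rwa [← mul_nsmul', mul_comm]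

end Torsion

/-! ## §3 The kernel of `θ` -/

variable [(curveOver (CompletedAlgClosure F) W).IsElliptic]

omit [CharZero F] [Fact (¬ IsUnit (p : integerC F))] [IsAdicComplete (Ideal.span {(p : integerC F)}) (integerC F)] in
/-- `p^N • ⟨t⟩ = 0` in `Ŵ(𝔪_{ℂ_F})` iff `p^N • P(t) = 0` in `E(ℂ_F)` (the group isomorphism `Ŵ(𝔪) ≅ E₁`, `ptHom`). [cite: SilvermanAEC2009, Prop. VII.2.2] -/
theorem nsmul_pt_eq_zero_of_nsmul_ptOfZ_eq_zero (t : (ballNilIdeal (CompletedAlgClosure F)).toIdeal) (n : ℕ)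
    (h : n • ptOfZ (CompletedAlgClosure F) W t = 0) : n • (⟨t⟩ : W.Pt (ballNilIdeal (CompletedAlgClosure F))) = 0 := by
  apply ptHom_injective (K := CompletedAlgClosure F) (W := W)
  rw [map_nsmul, map_zero, ptHom_apply]
  exact h

/-- ★★ **KERNEL of `θ` on the values of `log_W(ι[ũ])`.** Let `u` be a `[p]`-division sequence in `Ŵ(𝔪_{ℂ_F})` with `‖u₀‖ ≤ ‖p‖`, `k ≥ 1`, and `L` a value of
`log_W(ι[ũ])` modulo `Fil^k` with `θ(L) = 0`. Then for some `N`: `θ(p^N • [ũ]) = 0` in `Ŵ(𝔪_{ℂ_F})` and **`p^N · L − logKer(p^N • [ũ]) ∈ ξ^k B_dR⁺`**, `logKer` K1's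
`ξ`-adic logarithm of a `θ`-kernel point of `Ŵ(𝔫)` (`∈ Fil¹`; `= ∫_τ ω` on `T_pŴ`). (`0 = θ L = log_ω(P(u₀))` ⟹ `P(u₀)` torsion ⟹ `p^N • P(u₀) = 0`; `p^N • L` and
`logKer` are both values at `p^N • [ũ]`.) [cite: Fontaine1982FormesDifferentielles, §5] [cite: FontaineAsterisque223III, Exp. II §1.5]
[cite: SilvermanAEC2009, Thm. IV.6.4 with Prop. VII.2.2] -/
theorem IsFormalLogModFil.exists_pow_smul_sub_logKer_mem (hp : valuation F p < 1) {k : ℕ} (hk : 1 ≤ k)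
    {u : ℕ → (maxNilIdealC F).toIdeal} (hup : ∀ n, AinfTop.mulPC F p W (u (n + 1)) = u n)
    (hu : ‖(((u 0 : (maxNilIdealC F).toIdeal) : CBall F) : CompletedAlgClosure F)‖ ≤ ‖(p : CompletedAlgClosure F)‖)
    {L : BDeRhamPlus (integerC F) p} (hL : IsFormalLogModFil W k ((AinfTop.of F p).symm (AinfTop.torsionLift W hθ u hup)) L) (h0 : thetaBdR L = 0) :
    ∃ (N : ℕ) (hZ : AinfTop.thetaPt W hθ (p ^ N • AinfTop.divisionLiftPt W hθ u hup) = 0),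
      (p : BDeRhamPlus (integerC F) p) ^ N * L - (BdRPlusTop.of F p).symm (AinfTop.logKer W (p ^ N • AinfTop.divisionLiftPt W hθ u hup) hZ) ∈
        Ideal.span {(xiBdR : BDeRhamPlus (integerC F) p) ^ k} := by
  haveI : CharZero (CompletedAlgClosure F) := charZero_of_injective_algebraMap (algebraMap F _).injective
  have hpC : ‖(p : CompletedAlgClosure F)‖ < 1 := norm_natCast_C_lt_one hp
  have hp0C : (p : CompletedAlgClosure F) ≠ 0 := Nat.cast_ne_zero.2 (Fact.out : p.Prime).ne_zero
  have hpCv : NormedField.valuation (p : CompletedAlgClosure F) < 1 := by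
    rw [← NNReal.coe_lt_coe, NormedField.valuation_apply, coe_nnnorm]; exact hpC
  -- `log_ω(P(u₀)) = θ(L) = 0`, so `P(u₀)` is torsion, hence `p^N • P(u₀) = 0`
  have hlev := ptOfZ_mem_level W (K := CompletedAlgClosure F) (p := p) (t := u 0) hu
  have hlog : padicLogPointFiniteExt (NormedField.valuation (K := CompletedAlgClosure F)) (curveOver (CompletedAlgClosure F) W) p
      (ptOfZ (CompletedAlgClosure F) W (u 0)) = 0 := by
    rw [← hL.thetaBdR_eq_padicLogPointFiniteExt_ptOfZ hp W hk hup hu, h0]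
  have hfin : IsOfFinAddOrder (ptOfZ (CompletedAlgClosure F) W (u 0)) :=
    (padicLogPointFiniteExt_eq_zero_iff hp0C hpCv (limitLog_spec_of_completeSpace hp0C hpCv) one_pos (by rwa [one_nsmul])).1 hlog
  obtain ⟨N, hN⟩ := exists_pow_nsmul_eq_zero_of_isOfFinAddOrder W hpC hlev.1 hfin
  -- `θ(p^N • [ũ]) = p^N • θ[ũ] = p^N • ⟨u₀⟩ = 0`
  have hZ : AinfTop.thetaPt W hθ (p ^ N • AinfTop.divisionLiftPt W hθ u hup) = 0 := by
    rw [map_nsmul, AinfTop.thetaPt_divisionLiftPt]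
    exact nsmul_pt_eq_zero_of_nsmul_ptOfZ_eq_zero W (u 0) (p ^ N) hN
  refine ⟨N, hZ, ?_⟩
  -- both `p^N • L` and `logKer` are values at `p^N • [ũ]`
  have hθu : ‖(((AinfTop.thetaPt W hθ (AinfTop.divisionLiftPt W hθ u hup)).val : CBall F) : CompletedAlgClosure F)‖ ≤
      ‖(p : CompletedAlgClosure F)‖ := by
    rw [AinfTop.thetaPt_divisionLiftPt]; exact hu
  have hLN : IsFormalLogModFil W k ((AinfTop.of F p).symm ((p ^ N • AinfTop.divisionLiftPt W hθ u hup).val : AinfTop F p)) (p ^ N • L) :=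
    IsFormalLogModFil.nsmul_pt W hθu (by rw [AinfTop.coe_val_divisionLiftPt]; exact hL) (Nat.one_le_pow _ _ (Fact.out : p.Prime).pos)
  have hK := isFormalLogModFil_logKer W k (p ^ N • AinfTop.divisionLiftPt W hθ u hup) hZ
  have h := hLN.sub_mem_span_xiBdR_pow hK
  rwa [nsmul_eq_mul, Nat.cast_pow] at h

/-- ★ **Hence `p^N · L ∈ Fil¹ B_dR⁺ + ξ^k B_dR⁺`**: `θ(L) = 0 ⟹ ∃ N, ∃ b ∈ Fil¹ = (ξ_dR), p^N L − b ∈ ξ^k B_dR⁺` (with `b = logKer(p^N • [ũ])`, K1's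
`ξ`-adic `ω`-integral). [cite: Fontaine1982FormesDifferentielles, §5] [cite: FontaineAsterisque223III, Exp. II §1.5] -/
theorem IsFormalLogModFil.exists_pow_mul_sub_mem_of_thetaBdR_eq_zero (hp : valuation F p < 1) {k : ℕ} (hk : 1 ≤ k)
    {u : ℕ → (maxNilIdealC F).toIdeal} (hup : ∀ n, AinfTop.mulPC F p W (u (n + 1)) = u n)
    (hu : ‖(((u 0 : (maxNilIdealC F).toIdeal) : CBall F) : CompletedAlgClosure F)‖ ≤ ‖(p : CompletedAlgClosure F)‖)
    {L : BDeRhamPlus (integerC F) p} (hL : IsFormalLogModFil W k ((AinfTop.of F p).symm (AinfTop.torsionLift W hθ u hup)) L) (h0 : thetaBdR L = 0) :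
    ∃ (N : ℕ) (b : BdRPlusTop F p), b ∈ (BdRPlusTop.filOne F p).toIdeal ∧
      (p : BDeRhamPlus (integerC F) p) ^ N * L - (BdRPlusTop.of F p).symm b ∈ Ideal.span {(xiBdR : BDeRhamPlus (integerC F) p) ^ k} := by
  obtain ⟨N, hZ, h⟩ := hL.exists_pow_smul_sub_logKer_mem W hp hk hup hu h0
  exact ⟨N, _, AinfTop.logKer_mem_filOne W _ hZ, h⟩

/-! ## §4 The kernel in the currency of `T_pŴ`: `p^N • [ũ] = [ṽ]` for the torsion sequence `vₙ = [p^N]_W uₙ`, `logKer = ∫_v ω` -/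

section TateCurrency

variable {u : ℕ → (maxNilIdealC F).toIdeal}

omit [CharZero F] [Fact p.Prime] [Fact (¬ IsUnit (p : integerC F))] [IsAdicComplete (Ideal.span {(p : integerC F)}) (integerC F)]
  [(curveOver (CompletedAlgClosure F) W).IsElliptic] in
/-- `[p]_W` on `Ŵ(𝔪_{ℂ_F})` is `p • ·` in the group `W.Pt (maxNilIdealC F)`. [cite: SilvermanAEC2009, IV.2.3] -/
theorem mulPC_eq_val_nsmul (t : (maxNilIdealC F).toIdeal) : AinfTop.mulPC F p W t = (p • (⟨t⟩ : W.Pt (maxNilIdealC F))).val := by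
  rw [WeierstrassCurve.Pt.val_nsmul]; rfl

omit [CharZero F] [Fact p.Prime] [Fact (¬ IsUnit (p : integerC F))] [IsAdicComplete (Ideal.span {(p : integerC F)}) (integerC F)]
  [(curveOver (CompletedAlgClosure F) W).IsElliptic] in
/-- **The termwise multiple `vₙ = [n]_W uₙ` of a `[p]`-division sequence is a `[p]`-division sequence** (`Ŵ(𝔪_{ℂ_F})` is commutative).
[cite: SilvermanAEC2009, IV.2.3] -/
theorem mulPC_val_nsmul_pt (hup : ∀ n, AinfTop.mulPC F p W (u (n + 1)) = u n) (n : ℕ) (i : ℕ) :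
    AinfTop.mulPC F p W ((n • (⟨u (i + 1)⟩ : W.Pt (maxNilIdealC F))).val) = (n • (⟨u i⟩ : W.Pt (maxNilIdealC F))).val := by
  have hi : p • (⟨u (i + 1)⟩ : W.Pt (maxNilIdealC F)) = ⟨u i⟩ :=
    WeierstrassCurve.Pt.ext (by rw [← mulPC_eq_val_nsmul, hup])
  rw [mulPC_eq_val_nsmul, smul_smul, mul_comm, ← smul_smul, hi]

omit [(curveOver (CompletedAlgClosure F) W).IsElliptic] in
/-- ★ **`[ṽ] = n • [ũ]` in `Ŵ(𝔫)` for `vᵢ = [n]_W uᵢ`**: Fontaine's integration is `ℕ`-linear in the sequence (`divisionLiftPt_addSeq`, `divisionLiftPt_zero`).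
[cite: FontaineAsterisque223III, Exp. II §1.2.2] [cite: SilvermanAEC2009, IV.2.3] -/
theorem divisionLiftPt_val_nsmul_pt (hup : ∀ n, AinfTop.mulPC F p W (u (n + 1)) = u n) (n : ℕ) :
    AinfTop.divisionLiftPt W hθ (fun i => (n • (⟨u i⟩ : W.Pt (maxNilIdealC F))).val) (mulPC_val_nsmul_pt W hup n) =
      n • AinfTop.divisionLiftPt W hθ u hup := by
  induction n with
  | zero =>
    have h0 : (fun i => ((0 : ℕ) • (⟨u i⟩ : W.Pt (maxNilIdealC F))).val) = (0 : ℕ → (maxNilIdealC F).toIdeal) := by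
      funext i; rw [zero_nsmul, WeierstrassCurve.Pt.val_zero]; rfl
    rw [zero_nsmul, AinfTop.divisionLiftPt_congr W h0 (mulPC_val_nsmul_pt W hup 0) (AinfTop.mulPC_zeroSeq W), AinfTop.divisionLiftPt_zero]
  | succ n ih =>
    have hs : (fun i => ((n + 1) • (⟨u i⟩ : W.Pt (maxNilIdealC F))).val) =
        AinfTop.addSeq F W (fun i => (n • (⟨u i⟩ : W.Pt (maxNilIdealC F))).val) u := by
      funext i; rw [succ_nsmul, WeierstrassCurve.Pt.val_add]; rfl
    rw [succ_nsmul, AinfTop.divisionLiftPt_congr W hs (mulPC_val_nsmul_pt W hup (n + 1))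
      (AinfTop.mulPC_addSeq W (mulPC_val_nsmul_pt W hup n) hup),
      AinfTop.divisionLiftPt_addSeq W (u := fun i => (n • (⟨u i⟩ : W.Pt (maxNilIdealC F))).val) (u' := u)
        (mulPC_val_nsmul_pt W hup n) hup, ih]

/-- ★★ **KERNEL, `T_pŴ` form.** Let `u` be a `[p]`-division sequence in `Ŵ(𝔪_{ℂ_F})` with `‖u₀‖ ≤ ‖p‖`, `k ≥ 1`, `L` a value of `log_W(ι[ũ])` modulo `Fil^k`
with `θ(L) = 0`. Then for some `N` the termwise multiple `vᵢ = [p^N]_W uᵢ` is a TORSION sequence (`v₀ = 0`, i.e. `v ∈ T_pŴ(𝒪_{ℂ_F})`) and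
**`p^N · L − ∫_v ω ∈ ξ^k B_dR⁺`**, `∫_v ω = AinfTop.omegaPeriod W hθ v` the `ω`-period of K1 (`logKer [ṽ] = ∫_v ω`, `logKer_divisionLiftPt_of_zero`): the kernel of
`θ` on `X_W = ℚ_p·{log_W(ι[ũ])}` is `ℚ_p ⊗ ∫_{T_pŴ} ω` modulo `Fil^k` — Fontaine's exact sequence `0 → V_pŴ-periods → X_W → ℂ_F`.
[cite: Fontaine1982FormesDifferentielles, §5] [cite: FontaineAsterisque223III, Exp. II §1.5] [cite: SilvermanAEC2009, Thm. IV.6.4 with Prop. VII.2.2] -/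
theorem IsFormalLogModFil.exists_pow_mul_sub_omegaPeriod_mem (hp : valuation F p < 1) {k : ℕ} (hk : 1 ≤ k)
    (hup : ∀ n, AinfTop.mulPC F p W (u (n + 1)) = u n)
    (hu : ‖(((u 0 : (maxNilIdealC F).toIdeal) : CBall F) : CompletedAlgClosure F)‖ ≤ ‖(p : CompletedAlgClosure F)‖)
    {L : BDeRhamPlus (integerC F) p} (hL : IsFormalLogModFil W k ((AinfTop.of F p).symm (AinfTop.torsionLift W hθ u hup)) L) (h0 : thetaBdR L = 0) :
    ∃ (N : ℕ) (hv₀ : (((p ^ N • (⟨u 0⟩ : W.Pt (maxNilIdealC F))).val : (maxNilIdealC F).toIdeal) : CBall F) = 0),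
      (p : BDeRhamPlus (integerC F) p) ^ N * L -
        (BdRPlusTop.of F p).symm (AinfTop.omegaPeriod W hθ (fun i => (p ^ N • (⟨u i⟩ : W.Pt (maxNilIdealC F))).val) hv₀
          (mulPC_val_nsmul_pt W hup (p ^ N))) ∈ Ideal.span {(xiBdR : BDeRhamPlus (integerC F) p) ^ k} := by
  obtain ⟨N, hZ, hmem⟩ := hL.exists_pow_smul_sub_logKer_mem W hp hk hup hu h0
  -- `v₀ = 0`: `θ(p^N • [ũ]) = p^N • ⟨u₀⟩ = 0`
  have hv : p ^ N • (⟨u 0⟩ : W.Pt (maxNilIdealC F)) = 0 := by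
    rw [← AinfTop.thetaPt_divisionLiftPt W (hθ := hθ) u hup, ← map_nsmul]; exact hZ
  have hv₀ : (((p ^ N • (⟨u 0⟩ : W.Pt (maxNilIdealC F))).val : (maxNilIdealC F).toIdeal) : CBall F) = 0 := by
    rw [hv, WeierstrassCurve.Pt.val_zero]; rfl
  refine ⟨N, hv₀, ?_⟩
  -- `logKer(p^N • [ũ]) = logKer([ṽ]) = ∫_v ω`
  have hpt : p ^ N • AinfTop.divisionLiftPt W hθ u hup =
      AinfTop.divisionLiftPt W hθ (fun i => (p ^ N • (⟨u i⟩ : W.Pt (maxNilIdealC F))).val) (mulPC_val_nsmul_pt W hup (p ^ N)) :=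
    (divisionLiftPt_val_nsmul_pt W hup (p ^ N)).symm
  have hZ' : AinfTop.thetaPt W hθ (AinfTop.divisionLiftPt W hθ (fun i => (p ^ N • (⟨u i⟩ : W.Pt (maxNilIdealC F))).val)
      (mulPC_val_nsmul_pt W hup (p ^ N))) = 0 := by rw [← hpt]; exact hZ
  rwa [AinfTop.logKer_congr W hpt hZ hZ', AinfTop.logKer_divisionLiftPt_of_zero W hv₀] at hmem

end TateCurrency

/-! ## §5 Independence of the division sequence: `log_W(ι[ũ']) ≡ log_W(ι[ũ]) + ∫_{u' ⊖ u} ω` for two division sequences of the same point -/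

section Choice

variable {u u' : ℕ → (maxNilIdealC F).toIdeal}

omit [CharZero F] [Fact p.Prime] [Fact (¬ IsUnit (p : integerC F))] [IsAdicComplete (Ideal.span {(p : integerC F)}) (integerC F)]
  [(curveOver (CompletedAlgClosure F) W).IsElliptic] in
/-- Two division sequences with the same base point differ by a TORSION sequence: `(u' ⊖ u)₀ = 0`. [cite: SilvermanAEC2009, IV.2.3] -/
theorem coe_addSeq_negSeq_zero_of_eq (h0 : u' 0 = u 0) :
    ((AinfTop.addSeq F W u' (AinfTop.negSeq W u) 0 : (maxNilIdealC F).toIdeal) : CBall F) = 0 := by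
  have h : AinfTop.addSeq F W u' (AinfTop.negSeq W u) 0 = (((⟨u' 0⟩ : W.Pt (maxNilIdealC F)) + -⟨u 0⟩).val) := rfl
  rw [h, h0, add_neg_cancel, WeierstrassCurve.Pt.val_zero]; rfl

omit [CharZero F] [Fact p.Prime] [Fact (¬ IsUnit (p : integerC F))] [IsAdicComplete (Ideal.span {(p : integerC F)}) (integerC F)]
  [(curveOver (CompletedAlgClosure F) W).IsElliptic] in
/-- `u ⊕ (u' ⊖ u) = u'` termwise (`Ŵ(𝔪_{ℂ_F})` is an abelian group). [cite: SilvermanAEC2009, IV.2.3] -/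
theorem addSeq_addSeq_negSeq (u u' : ℕ → (maxNilIdealC F).toIdeal) :
    AinfTop.addSeq F W u (AinfTop.addSeq F W u' (AinfTop.negSeq W u)) = u' := by
  funext n
  have h : AinfTop.addSeq F W u (AinfTop.addSeq F W u' (AinfTop.negSeq W u)) n =
      ((⟨u n⟩ : W.Pt (maxNilIdealC F)) + (⟨u' n⟩ + -⟨u n⟩)).val := rfl
  rw [h, add_comm (⟨u' n⟩ : W.Pt (maxNilIdealC F)), ← add_assoc, add_neg_cancel, zero_add]

omit [(curveOver (CompletedAlgClosure F) W).IsElliptic] in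
/-- ★★ **The integrating element is independent of the division sequence, up to periods.** Let `u`, `u'` be two `[p]`-division sequences in
`Ŵ(𝔪_{ℂ_F})` of the SAME point `u₀ = u'₀ ∈ Ŵ(p𝒪_{ℂ_F})` and `L`, `L'` values of `log_W(ι[ũ])`, `log_W(ι[ũ'])` modulo `Fil^k`. Then with the torsion sequence
`t = u' ⊖ u ∈ T_pŴ(𝒪_{ℂ_F})`: **`L' − L − ∫_t ω ∈ ξ^k B_dR⁺`** (`[ũ'] = [ũ] + [t̃]`, `∫_t ω` is a value at `[t̃]`, additivity, uniqueness). So `P ↦ log_W(ι[ũ]) mod (Fil^k +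
∫_{T_pŴ} ω)` is well defined on `Ŵ(p𝒪_{ℂ_F})`. [cite: Fontaine1982FormesDifferentielles, §5] [cite: BlochKato1990, Ex. 3.10.1] -/
theorem IsFormalLogModFil.sub_sub_omegaPeriod_mem_of_base_eq {k : ℕ} (hup : ∀ n, AinfTop.mulPC F p W (u (n + 1)) = u n)
    (hup' : ∀ n, AinfTop.mulPC F p W (u' (n + 1)) = u' n) (h0 : u' 0 = u 0)
    (hu : ‖(((u 0 : (maxNilIdealC F).toIdeal) : CBall F) : CompletedAlgClosure F)‖ ≤ ‖(p : CompletedAlgClosure F)‖)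
    {L L' : BDeRhamPlus (integerC F) p} (hL : IsFormalLogModFil W k ((AinfTop.of F p).symm (AinfTop.torsionLift W hθ u hup)) L)
    (hL' : IsFormalLogModFil W k ((AinfTop.of F p).symm (AinfTop.torsionLift W hθ u' hup')) L') :
    L' - L - (BdRPlusTop.of F p).symm (AinfTop.omegaPeriod W hθ (AinfTop.addSeq F W u' (AinfTop.negSeq W u)) (coe_addSeq_negSeq_zero_of_eq W h0)
      (AinfTop.mulPC_addSeq W hup' (AinfTop.mulPC_negSeq W hup))) ∈ Ideal.span {(xiBdR : BDeRhamPlus (integerC F) p) ^ k} := by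
  set t : ℕ → (maxNilIdealC F).toIdeal := AinfTop.addSeq F W u' (AinfTop.negSeq W u) with ht
  have htp : ∀ n, AinfTop.mulPC F p W (t (n + 1)) = t n := AinfTop.mulPC_addSeq W hup' (AinfTop.mulPC_negSeq W hup)
  have ht0 : ((t 0 : (maxNilIdealC F).toIdeal) : CBall F) = 0 := coe_addSeq_negSeq_zero_of_eq W h0
  -- `∫_t ω` is a value at `[t̃]`, `L + ∫_t ω` a value at `[ũ] + [t̃] = [ũ']`
  have hΩ : IsFormalLogModFil W k ((AinfTop.of F p).symm ((AinfTop.divisionLiftPt W hθ t htp).val : AinfTop F p))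
      ((BdRPlusTop.of F p).symm (AinfTop.omegaPeriod W hθ t ht0 htp)) := by
    rw [AinfTop.coe_val_divisionLiftPt]; exact isFormalLogModFil_omegaPeriod W k ht0 htp
  have huI : (AinfTop.of F p).symm ((AinfTop.divisionLiftPt W hθ u hup).val : AinfTop F p) ∈ Ideal.span {(p : Ainf (p := p) F), xi} :=
    mem_span_p_xi_of_norm_thetaPt_le W (by rw [AinfTop.thetaPt_divisionLiftPt]; exact hu)
  have htI : (AinfTop.of F p).symm ((AinfTop.divisionLiftPt W hθ t htp).val : AinfTop F p) ∈ Ideal.span {(p : Ainf (p := p) F), xi} :=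
    mem_span_p_xi_of_norm_thetaPt_le W (by
      rw [AinfTop.thetaPt_divisionLiftPt, ht0, ZeroMemClass.coe_zero, norm_zero]; exact norm_nonneg _)
  have hsum := IsFormalLogModFil.addW W huI htI (by rw [AinfTop.coe_val_divisionLiftPt]; exact hL) hΩ
  have hpt : AinfTop.divisionLiftPt W hθ u hup + AinfTop.divisionLiftPt W hθ t htp = AinfTop.divisionLiftPt W hθ u' hup' := by
    rw [← AinfTop.divisionLiftPt_addSeq W hup htp]
    exact AinfTop.divisionLiftPt_congr W (addSeq_addSeq_negSeq W u u') _ hup'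
  rw [← AinfTop.val_add_N, hpt, AinfTop.coe_val_divisionLiftPt] at hsum
  have h := hL'.sub_mem_span_xiBdR_pow hsum
  rwa [← sub_sub] at h

end Choice

end GaloisContinuity

end Literature.NumberTheory.PAdicHodge

end
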